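import Summits.MatrixMultiplication.OmegaCensus.DicyclicLawRankThreeQuotient
import Summits.MatrixMultiplication.OmegaCensus.C2C2QuaternionTwoPowLaw
import HarnessLib

/-!
# `C₂² × Q_{4m}`, `m` even: the dicyclic law `(64m − 16)/3` is never attained; `β(C₂² × Q_{4m}) ≤ (64m − 28)/3` for all `m ≡ 4 (mod 6)`, `m ≥ 10`

ω-census `pub-omega`, family (b3), seat pub-omega-group gen 13.  Framing: lottery ticket; floor = certified bounds/negative
ranges.  VALUE: kernel census clauses (group-theoretic method); NOT progress on ω.

`C₂² × Q_{4m} = G(ℤ₂ × ℤ₂ × ℤ_{2m}, (0,0,m))`; for EVEN `m ≥ 8` the quotient `A/⟨c₀⟩ = ℤ₂² × ℤ_m` has `2`-rank `3` (the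
characters `x`, `y`, `z mod 2` kill `c₀ = (0,0,m)`), so gen 13's `no_dicyclic_law_of_rank_three_quot` applies — NO
`2`-power hypothesis on `m` (gen 12's `c2c2_quaternion_no_dicyclic_law_two_pow` needed `m = 2^k`):

* `c2c2_quaternion_no_dicyclic_law_even`: **no TPP triple of `C₂² × Q_{4m}` (`m` even, `m ≥ 8`) attains
  `3|S||T||U| + 16 = 64m`**;
* `c2c2_quaternion_mod_six_four_le`: for `m ≡ 4 (mod 6)`, `m ≥ 10` (`m = 10, 16, 22, 28, …`), **`3|S||T||U| + 28 ≤ 64m`**, i.e.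
  `β(C₂² × Q_{4m}) ≤ (64m − 28)/3`: the window `[(64m−64)/3, (64m−16)/3]` of `c2c2_quaternion_window_mod_six_four` shrinks
  to `[(64m−64)/3, (64m−28)/3]` for the WHOLE residue class.  E.g. **`β(C₂² × Q₄₀) ∈ [192, 204]`** (law `208` excluded),
  `β(C₂² × Q₈₈) ∈ [448, 460]`, `β(C₂² × Q₁₁₂) ∈ [576, 588]`.
The member `m = 4` (`|A| = 32 < 50`) is the certified value `β(C₂² × Q₁₆) = 64`.
-/

namespace Summit.MatrixMultiplication.OmegaCensus

open Literature.Combinatorics.Additive Finset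

section C2C2QEven

variable {m : ℕ} [NeZero m]

/-- **`C₂² × Q_{4m}`, `m` even, `m ≥ 8`: the dicyclic law is not attained.**  For every TPP triple `(S,T,U)` of
`C₂² × Q_{4m}`: `3|S||T||U| + 16 ≠ 64m`. [folklore] -/
theorem c2c2_quaternion_no_dicyclic_law_even (hm2 : 2 ∣ m) (hm8 : 8 ≤ m)
    {S T U : Finset (Multiplicative (ZMod 2) × (Multiplicative (ZMod 2) × QuaternionGroup m))}
    (h : TripleProductProperty S T U) : 3 * (S.card * T.card * U.card) + 16 ≠ 64 * m := by
  haveI : NeZero (2 * m) := ⟨by omega⟩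
  obtain ⟨hc₀', -⟩ := z2_z2_z2m_quot_noncyclic (m := m)
  refine c2_quaternion_presentation (m := m) fun ρ τ c₀ hρρ hρτ hτρ hττ hρ hτ hne hsurj hc => ?_
  subst hc
  refine c2_product_presentation hρρ hρτ hτρ hττ hρ hτ hne hsurj
    fun ρ' τ' c₀' hρρ' hρτ' hτρ' hττ' hρ' hτ' hne' hsurj' hc' => ?_
  subst hc'
  have hcard : Fintype.card (ZMod 2 × (ZMod 2 × ZMod (2 * m))) = 8 * m := by
    rw [Fintype.card_prod, Fintype.card_prod, ZMod.card, ZMod.card]; ring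
  -- the three characters `x`, `y`, `z mod 2`
  let ψ₁ : ZMod 2 × (ZMod 2 × ZMod (2 * m)) →+ ZMod 2 := AddMonoidHom.fst _ _
  let ψ₂ : ZMod 2 × (ZMod 2 × ZMod (2 * m)) →+ ZMod 2 := (AddMonoidHom.fst _ _).comp (AddMonoidHom.snd _ _)
  let ψ₃ : ZMod 2 × (ZMod 2 × ZMod (2 * m)) →+ ZMod 2 :=
    (ZMod.castHom (show 2 ∣ 2 * m from dvd_mul_right 2 m) (ZMod 2)).toAddMonoidHom.comp
      ((AddMonoidHom.snd _ _).comp (AddMonoidHom.snd _ _))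
  have hψ₃ : ∀ p : ZMod 2 × (ZMod 2 × ZMod (2 * m)),
      ψ₃ p = ZMod.castHom (show 2 ∣ 2 * m from dvd_mul_right 2 m) (ZMod 2) p.2.2 := fun p => rfl
  have hψc : ψ₁ (0, (0, (m : ZMod (2 * m)))) = 0 ∧ ψ₂ (0, (0, (m : ZMod (2 * m)))) = 0 ∧
      ψ₃ (0, (0, (m : ZMod (2 * m)))) = 0 := by
    refine ⟨rfl, rfl, ?_⟩
    rw [hψ₃]
    show ZMod.castHom _ (ZMod 2) ((m : ℕ) : ZMod (2 * m)) = 0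
    rw [map_natCast]; exact (ZMod.natCast_eq_zero_iff m 2).2 hm2
  have hψ : ∀ v : ZMod 2 × ZMod 2 × ZMod 2, ∃ x, (ψ₁ x, ψ₂ x, ψ₃ x) = v := by
    rintro ⟨v₁, v₂, v₃⟩
    refine ⟨(v₁, (v₂, ((v₃.val : ℕ) : ZMod (2 * m)))), ?_⟩
    simp only [Prod.mk.injEq]
    refine ⟨rfl, rfl, ?_⟩
    rw [hψ₃]
    show ZMod.castHom _ (ZMod 2) ((v₃.val : ℕ) : ZMod (2 * m)) = v₃
    rw [map_natCast, ZMod.natCast_zmod_val]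
  -- the quotient map `π = (id, id, mod m)` onto `ℤ₂ × ℤ₂ × ℤ_m`
  let π : ZMod 2 × (ZMod 2 × ZMod (2 * m)) →+ ZMod 2 × (ZMod 2 × ZMod m) :=
    (AddMonoidHom.fst _ _).prod (((AddMonoidHom.fst _ _).comp (AddMonoidHom.snd _ _)).prod
      ((ZMod.castHom (dvd_mul_left m 2) (ZMod m)).toAddMonoidHom.comp
        ((AddMonoidHom.snd _ _).comp (AddMonoidHom.snd _ _))))
  have hπ : ∀ p : ZMod 2 × (ZMod 2 × ZMod (2 * m)),
      π p = (p.1, (p.2.1, ZMod.castHom (dvd_mul_left m 2) (ZMod m) p.2.2)) := fun p => rfl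
  have hker : ∀ a, π a = 0 ↔ a = 0 ∨ a = (0, (0, (m : ZMod (2 * m)))) := by
    intro a
    rw [hπ, Prod.mk_eq_zero, Prod.mk_eq_zero, zmod_castHom_two_mul_eq_zero_iff]
    constructor
    · rintro ⟨h1, h2, h3 | h3⟩
      · left; exact Prod.ext h1 (Prod.ext h2 h3)
      · right; exact Prod.ext h1 (Prod.ext h2 h3)
    · rintro (rfl | rfl)
      · exact ⟨rfl, rfl, Or.inl rfl⟩
      · exact ⟨rfl, rfl, Or.inr rfl⟩
  have hπs : Function.Surjective π := by
    rintro ⟨x, y, w⟩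
    refine ⟨(x, (y, ((w.val : ℕ) : ZMod (2 * m)))), ?_⟩
    rw [hπ]
    simp only
    rw [map_natCast, ZMod.natCast_zmod_val]
  have key := no_dicyclic_law_of_rank_three_quot hρρ' hρτ' hτρ' hττ' hc₀' hρ' hτ' hne' hsurj' (by rw [hcard]; omega)
    ψ₁ ψ₂ ψ₃ hψc hψ π hπs hker h
  rwa [hcard, show 8 * (8 * m) = 64 * m by ring] at key

/-- **`β(C₂² × Q_{4m}) ≤ (64m − 28)/3` for every `m ≡ 4 (mod 6)`, `m ≥ 10`**: for every TPP triple,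
`3|S||T||U| + 28 ≤ 64m` (window theorem + `c2c2_quaternion_no_dicyclic_law_even` + the mod-12 gap). [folklore] -/
theorem c2c2_quaternion_mod_six_four_le (h4 : m % 6 = 4) (hm10 : 10 ≤ m)
    {S T U : Finset (Multiplicative (ZMod 2) × (Multiplicative (ZMod 2) × QuaternionGroup m))}
    (h : TripleProductProperty S T U) : 3 * (S.card * T.card * U.card) + 28 ≤ 64 * m := by
  haveI : NeZero (2 * m) := ⟨by omega⟩
  have hne16 := c2c2_quaternion_no_dicyclic_law_even (m := m) ⟨m / 2, by omega⟩ (by omega) h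
  obtain ⟨hwin, -⟩ := c2c2_quaternion_window_mod_six_four (m := m) h4
  have h16 := hwin S T U h
  have hgap : 3 * (S.card * T.card * U.card) + 4 = 8 * (8 * m) ∨ 3 * (S.card * T.card * U.card) + 16 = 8 * (8 * m) ∨
      3 * (S.card * T.card * U.card) + 28 = 8 * (8 * m) ∨ 3 * (S.card * T.card * U.card) + 32 ≤ 8 * (8 * m) := by
    refine c2_quaternion_presentation (m := m) fun ρ τ c₀ hρρ hρτ hτρ hττ hρ hτ hne hsurj hc => ?_
    refine c2_product_presentation hρρ hρτ hτρ hττ hρ hτ hne hsurj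
      fun ρ' τ' c₀' hρρ' hρτ' hτρ' hττ' hρ' hτ' hne' hsurj' hc' => ?_
    have hcard : Fintype.card (ZMod 2 × (ZMod 2 × ZMod (2 * m))) = 8 * m := by
      rw [Fintype.card_prod, Fintype.card_prod, ZMod.card, ZMod.card]; ring
    have key := tpp_volume_mod_two_gap12 hρρ' hρτ' hτρ' hττ' hρ' hτ' hne' hsurj' (by rw [hcard]; omega)
      (by rw [hcard]; omega) h
    rwa [hcard] at key
  omega

/-- **`β(C₂² × Q₄₀) ≤ 204`** (law `208` excluded; window `[192, 204]` with the product lower bound). [folklore] -/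
theorem c2c2_quaternion_40_le
    {S T U : Finset (Multiplicative (ZMod 2) × (Multiplicative (ZMod 2) × QuaternionGroup 10))}
    (h : TripleProductProperty S T U) : S.card * T.card * U.card ≤ 204 := by
  have := c2c2_quaternion_mod_six_four_le (m := 10) (by norm_num) (le_refl _) h
  omega

end C2C2QEven

end Summit.MatrixMultiplication.OmegaCensus
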